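import Summits.HodgeConjecture.HodgeConjecture.Theorems.F0P3SpectralPacketH      -- ★ (N) FILE 3g (this seat): `ArchPacketKitH`, `trPktInfH`, `endoTrPktInf`, `SpectralPacketH`, `imageG`, `ramFinsetH`, `trFinAt` (+ ★ 3f `evpGψ`∕`trSψ`; ★ 3d; ★ 3a; ★ 2∕2b; ★ 1)
import Literature.NumberTheory.Rogawski1990.TestFunctionsPair                   -- ★ `UnitaryGroup.PureTensor₂ L H₂ H₁` (`eval`, `unramifiedSet`, `IsUnramified₂`, `unit`) — pure tensors on `H(𝔸) = U(H₂)(𝔸) × U(H₁)(𝔸)`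
import HarnessLib

/-!
# (N) DEFS, FILE 3h — THE `H`-SIDE OF THE SPECTRAL TUPLE, II: `trH` TOTAL ON `TestH L = C_c(H(𝔸))` (twin of ★ FILE 3d over ★ `PureTensor₂`), the endoscopic readings
# `endoTrPkt` ∕ `trHSψ` of `Tr ρ` on `G′`-data (slot `trHS`), and `evpHψ` (slot `evpH`) — Rogawski §13.1 Thm. 13.1.1 (2) p. 198, §13.3 p. 203, §14.3 pp. 233–234, §14.6 p. 243, §4.9 p. 54

Cell `hodgecm-mathlib` (D-0151), F0∕P3 «U3-mult», crux H413 (`stmt-HodgeConjecture-24833`), route of record `HCCMUnconditional`.  (N) lead pen F0P3a-p01 (g12); census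
`F0/P3a/F0P3a-p01/g12/CENSUS-N-FILE3-WIRING.F0P3a-p01g12.md` 9c106a7a §W1 rows #6 #8 #14, §W2 FILE 3h; LEAD F0P3a-plan (g10).  Definition lane (data `def`s with explicit
binders + three `Prop`-predicates with explicit binders) + `rfl`∕`dif`∕short read-backs; namespaces ★ FILE 1 (`…F0P3LocalPacketKit.LocalPacketKit`), ★ `…UnitaryGroup.PureTensor₂`,
★ FILE 2 (`…F0P3GlobalPacket.GlobalPacket`), ★ FILE 3a∕3g (`…F0P3SpectralPacket.SpectralPacketH`); box-before-file (B-typ03); `--supports stmt-HodgeConjecture-24833 --as helper`.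
No instance, no notation, no named fact, no `sorry`; no `Classical` instance in any statement (the choice lives inside `trH`'s body).
HONEST LABEL: HC_CM is proved only modulo the printed citations until rung 0 closes; this file proves no printed statement — it DEFINES the `H`-side trace slots of the tuple over the
posited kits (★ FILE 1 `trPktH`∕`xiH`∕`pair`, ★ FILE 3g `ArchPacketKitH`) and names their ONE residual law (TF-ind)-H `PresentationIndepH` + the normalisation (TF-1)-H `UnramTraceOneH`.

PRINT.  Clause (T) of `K9SpectralLetter` reads `trH ρ f^H` only at MATCHED `f^H`, which pin (xi″-c) `PinTransferHIff` (★ `IsPinned.deltaTransfer_tensors`) makes UNRAMIFIED₂ pure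
tensors `⇑f^H = TH.eval` on `H(𝔸)` [§14.3 pp. 233–234] — so, exactly as on the `G`-side (★ FILE 3d), `Tr ρ(f^H) := Tr ρ_∞(f^H_∞) · ∏_v Tr ρ_v(f^H_v)` [§13.3 p. 203; L-packets of `H`:
all coefficients `1`, Thm. 13.1.1] is DEFINED on those tensors and `0` elsewhere.  On `G′`-data the `H`-side traces are read through the endoscopic character identities
`Tr ρ_v(f^H_v) = Σ_{π ∈ Π(ρ_v)} ⟨ρ_v, π⟩ Tr π(f_v)` [Thm. 13.1.1 (2); §4.9; at `∞` Prop. 12.3.3] — the shape of ★ FILE 1's law (ℓ2) `CharIdentityLaw` — and the identification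
`G′_v = G_v` by `ψ_v` [§14.2 p. 232; §14.6 p. 243].

CONTENTS.
* §0 `LocalPacketKit.endoTrPkt 𝔩 νG ρ f := Σ_{π ∈ mem (xiH ρ)} ⟨ρ, π⟩ · Tr π(f)` (the right-hand side of (ℓ2), named) + `endoTrPkt_eq`; `CharIdentityLaw.trPktH_eq_endoTrPkt` (under (ℓ2), at
  matched smooth `(f^H, f)` and `regH ρ`: `trPktH νH ρ f^H = endoTrPkt νG ρ f`).
* §1 `PureTensor₂.ofUnramified₂ S locS a` (bad set `S`, INTEGRAL levels, factors `locS` on `S`, units off `S`; generic `N₂ N₁ H₂ H₁`) + `_S`, `_isUnramified₂`, `loc_ofUnramified₂_of_mem`,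
  `loc_ofUnramified₂_of_isUnramified₂`, **`eval_ofUnramified₂_of_isUnramified₂`** (re-presenting an unramified₂ tensor at the integral levels with a larger bad set does not change the function).
* §2 (h1) `SpectralPacketH.IsTestPresentationH ρ F TH`; (h2) `trTensorH ρ νH archTrH TH := trPktInfH archTrH ρ.inf TH.arch * ∏_{v∈TH.S} trFinAt ρ v (νH v) (TH.loc v)`; (h3) **`trH ρ νH archTrH :
  TestH L → ℂ`** — THE TUPLE'S `trH ρ` (junk `0` off the presented tensors); (h4) the law (TF-ind)-H `PresentationIndepH`; (h5) the normalisation (TF-1)-H `UnramTraceOneH`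
  («`Tr ρ_v(1_{K_{H,v}}) = 1` where `ξ_H(ρ_v)` is unramified»); read-backs `trH_of_not`, `trH_eq_trTensorH (hind)`, `exists_isTestPresentationH (hT : TH.IsUnramified₂) (hF)`, `trTensorH_eq_prod_of_subset (h1)`.
* §3 (h6) `GlobalPacket.evpAtψ Pg ψ νG` (★ FILE 3f `evpGψ` at the finite-part level; `SpectralPacketG.evpGψ_eq_evpAtψ : Q.evpGψ ψ νG = Q.fin.evpAtψ ψ νG`, `rfl`) and **`SpectralPacketH.evpHψ ρ ψ νG
  := ρ.imageG.evpAtψ ψ νG`** — THE TUPLE'S `evpH ρ` (`t(ρ)` pushed to `G` by `ξ_H`, read on `G′_v`; (P5) by definition: `evpHψ_of_not`).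
* §4 (h7) **`SpectralPacketH.trHSψ ρ ψ S νG archTr′ fS := 𝔞H.endoTrPktInf archTr′ ρ.inf fS.arch * ∏_{v∈S} (𝔩 v).endoTrPkt (νG v) (ρ.fin.loc v) (fS.loc v ∘ ψ_v⁻¹)`** — THE TUPLE'S `trHS S ρ` on
  the `G′`-semilocal datum ★ `TestS₀` (twin of ★ FILE 3f `trSψ`) + `trHSψ_eq`.

References: [Rogawski1990] §13.1 Thm. 13.1.1 p. 198, p. 199; §13.3 p. 203; §4.9 p. 54; §12.3 Prop. 12.3.3 p. 178; §14.2 p. 232; §14.3 pp. 233–234; §14.6 p. 243; §13.7 p. 206.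
[BorelJacquet1979] §4.1.  [CartierCorvallis1979] §IV.1.
-/

set_option autoImplicit false
-- the mandated namespace repeats `HodgeConjecture.HodgeConjecture`, as in every `Theorems/*.lean` of this sub-problem
set_option linter.dupNamespace false

noncomputable section

open NumberField IsDedekindDomain MeasureTheory Filter
open scoped Matrix MatrixGroups

open Literature.NumberTheory Literature.NumberTheory.Automorphic Literature.NumberTheory.Automorphic.UnitaryGroup
open Literature.NumberTheory.Rogawski1990 Literature.NumberTheory.GaloisRepresentations
open Literature.RepresentationTheory.BorelWallach2000 Literature.RepresentationTheory.KonnoKonno2007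
open Summit.HodgeConjecture.HodgeConjecture.Cruxes.H413.F0P3InnerFormClassificationV6 (TestG TestH splitForm)
open Summit.HodgeConjecture.HodgeConjecture.Cruxes.H413.F0P3ArchPacketKit
open Summit.HodgeConjecture.HodgeConjecture.Cruxes.H413.F0P3SemilocalTestFunctionsOfRecord (TestS₀)

/-! ## §0 The endoscopic reading of an `H_v`-packet trace on `G_v`-data [Thm. 13.1.1 (2)] -/

namespace Summit.HodgeConjecture.HodgeConjecture.Cruxes.H413.F0P3LocalPacketKit.LocalPacketKit

variable {L : Type} [Field L] [NumberField L] [IsCMField L] {H' : Matrix (Fin 3) (Fin 3) L} {v : HeightOneSpectrum (𝓞 ↥(maximalRealSubfield L))}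

/-- **`𝔩.endoTrPkt νG ρ f := Σ_{π ∈ Π(ρ)} ⟨ρ, π⟩ · Tr π(f)`** — the ENDOSCOPIC READING of `Tr ρ(f^H)` on the `G_v`-test function `f` (the right-hand side of the kit law (ℓ2)
`CharIdentityLaw`: ★ FILE 1 `xiH`, `pair`, `mem`; member characters ★ `IrrClass.smoothTrace`). [cite: Rogawski1990, §13.1 Thm. 13.1.1 p. 198; §4.9 p. 54] -/
def endoTrPkt (𝔩 : LocalPacketKit L H' v) [MeasurableSpace ((UnitaryGroup.cmDatum L 3 H').Local v)] (νG : Measure ((UnitaryGroup.cmDatum L 3 H').Local v))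
    (ρ : 𝔩.PktH) (f : (UnitaryGroup.cmDatum L 3 H').Local v → ℂ) : ℂ :=
  ∑ π ∈ 𝔩.mem (𝔩.xiH ρ), (𝔩.pair ρ π : ℂ) * π.smoothTrace νG f

/-- Unfolding of `endoTrPkt`. [cite: Rogawski1990, §13.1 Thm. 13.1.1 p. 198] -/
theorem endoTrPkt_eq (𝔩 : LocalPacketKit L H' v) [MeasurableSpace ((UnitaryGroup.cmDatum L 3 H').Local v)] (νG : Measure ((UnitaryGroup.cmDatum L 3 H').Local v))
    (ρ : 𝔩.PktH) (f : (UnitaryGroup.cmDatum L 3 H').Local v → ℂ) :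
    𝔩.endoTrPkt νG ρ f = ∑ π ∈ 𝔩.mem (𝔩.xiH ρ), (𝔩.pair ρ π : ℂ) * π.smoothTrace νG f :=
  rfl

/-- **Under (ℓ2) `CharIdentityLaw`, at a matched smooth pair `(f^H, f)` and `regH ρ`: `Tr ρ(f^H) = 𝔩.endoTrPkt νG ρ f`.** [cite: Rogawski1990, §13.1 Thm. 13.1.1 p. 198; §4.9 p. 54] -/
theorem CharIdentityLaw.trPktH_eq_endoTrPkt (𝔩 : LocalPacketKit L H' v) [MeasurableSpace ((UnitaryGroup.cmDatum L 3 H').Local v)]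
    [MeasurableSpace ((UnitaryGroup.cmDatum L 2 (Matrix.of fun i j : Fin 2 => if i.val + j.val + 1 = 2 then (1 : L) else 0)).Local v ×
      (UnitaryGroup.cmDatum L 1 (Matrix.of fun i j : Fin 1 => if i.val + j.val + 1 = 1 then (1 : L) else 0)).Local v)]
    {νG : Measure ((UnitaryGroup.cmDatum L 3 H').Local v)}
    {νH : Measure ((UnitaryGroup.cmDatum L 2 (Matrix.of fun i j : Fin 2 => if i.val + j.val + 1 = 2 then (1 : L) else 0)).Local v ×
      (UnitaryGroup.cmDatum L 1 (Matrix.of fun i j : Fin 1 => if i.val + j.val + 1 = 1 then (1 : L) else 0)).Local v)}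
    {Δ : LocalTransferFactor L H' v}
    {mH : OrbitalMeasureFamily ((UnitaryGroup.cmDatum L 2 (Matrix.of fun i j : Fin 2 => if i.val + j.val + 1 = 2 then (1 : L) else 0)).Local v ×
      (UnitaryGroup.cmDatum L 1 (Matrix.of fun i j : Fin 1 => if i.val + j.val + 1 = 1 then (1 : L) else 0)).Local v)}
    {mG : OrbitalMeasureFamily ((UnitaryGroup.cmDatum L 3 H').Local v)}
    (h : 𝔩.CharIdentityLaw νG νH Δ mH mG) {ρ : 𝔩.PktH} (hρ : 𝔩.regH ρ)
    {fH : (UnitaryGroup.cmDatum L 2 (Matrix.of fun i j : Fin 2 => if i.val + j.val + 1 = 2 then (1 : L) else 0)).Local v ×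
      (UnitaryGroup.cmDatum L 1 (Matrix.of fun i j : Fin 1 => if i.val + j.val + 1 = 1 then (1 : L) else 0)).Local v → ℂ}
    {f : (UnitaryGroup.cmDatum L 3 H').Local v → ℂ} (hfH : IsLocSmooth fH) (hf : IsLocSmooth f) (hm : IsLocalDeltaTransfer L H' v Δ mH mG fH f) :
    𝔩.trPktH νH ρ fH = 𝔩.endoTrPkt νG ρ f :=
  h ρ hρ fH f hfH hf hm

end Summit.HodgeConjecture.HodgeConjecture.Cruxes.H413.F0P3LocalPacketKit.LocalPacketKit

/-! ## §1 Re-presenting an unramified₂ pure tensor on `H(𝔸)` at the integral levels [§14.3 p. 233; BorelJacquet §4.1] -/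

namespace Literature.NumberTheory.Automorphic.UnitaryGroup.PureTensor₂

variable {L : Type} [Field L] [NumberField L] [IsCMField L] {N₂ N₁ : ℕ} {H₂ : Matrix (Fin N₂) (Fin N₂) L} {H₁ : Matrix (Fin N₁) (Fin N₁) L}

variable (L H₂ H₁) in
/-- **`ofUnramified₂ S locS a`** — the pure tensor on `U(H₂)(𝔸) × U(H₁)(𝔸)` with bad set `S`, INTEGRAL levels at every `v`, local factors `locS v` on `S` and the unit
`1_{U(H₂)(𝒪_v) × U(H₁)(𝒪_v)}` off `S`, archimedean factor `a` (twin of ★ `PureTensor.ofUnramified`). [cite: Rogawski1990, §14.3 p. 233; §4.9 p. 54] [cite: BorelJacquet1979, §4.1] -/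
def ofUnramified₂ (S : Finset (HeightOneSpectrum (𝓞 ↥(maximalRealSubfield L))))
    (locS : ∀ v : HeightOneSpectrum (𝓞 ↥(maximalRealSubfield L)), (cmDatum L N₂ H₂).Local v × (cmDatum L N₁ H₁).Local v → ℂ)
    (a : UnitaryGroup.arch (↥(maximalRealSubfield L)) L (IsCMField.complexConj L) N₂ H₂ ×
      UnitaryGroup.arch (↥(maximalRealSubfield L)) L (IsCMField.complexConj L) N₁ H₁ → ℂ) : PureTensor₂ L H₂ H₁ where
  S := S
  K₂ := fun v => cmLocalIntegralLevel L N₂ H₂ v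
  K₁ := fun v => cmLocalIntegralLevel L N₁ H₁ v
  loc := fun v => open scoped Classical in
    if v ∈ S then locS v else (((cmLocalIntegralLevel L N₂ H₂ v : Set ((cmDatum L N₂ H₂).Local v)) ×ˢ
      (cmLocalIntegralLevel L N₁ H₁ v : Set ((cmDatum L N₁ H₁).Local v)))).indicator fun _ => 1
  arch := a
  loc_eq_indicator := fun v hv => by simp only [if_neg hv]

variable (S : Finset (HeightOneSpectrum (𝓞 ↥(maximalRealSubfield L))))
  (locS : ∀ v : HeightOneSpectrum (𝓞 ↥(maximalRealSubfield L)), (cmDatum L N₂ H₂).Local v × (cmDatum L N₁ H₁).Local v → ℂ)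
  (a : UnitaryGroup.arch (↥(maximalRealSubfield L)) L (IsCMField.complexConj L) N₂ H₂ ×
    UnitaryGroup.arch (↥(maximalRealSubfield L)) L (IsCMField.complexConj L) N₁ H₁ → ℂ)

/-- The bad set of `ofUnramified₂ S …` is `S`. [cite: Rogawski1990, §14.3 p. 233] -/
@[simp] theorem ofUnramified₂_S : (ofUnramified₂ L H₂ H₁ S locS a).S = S := rfl

/-- `ofUnramified₂ …` has integral levels off (indeed at) every place. [cite: Rogawski1990, §4.9 p. 54] -/
theorem ofUnramified₂_isUnramified₂ : (ofUnramified₂ L H₂ H₁ S locS a).IsUnramified₂ :=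
  fun _ _ => ⟨rfl, rfl⟩

/-- On `S` the local factor is the given one. [cite: Rogawski1990, §14.3 p. 233] -/
theorem loc_ofUnramified₂_of_mem {v : HeightOneSpectrum (𝓞 ↥(maximalRealSubfield L))} (hv : v ∈ S) :
    (ofUnramified₂ L H₂ H₁ S locS a).loc v = locS v := by
  classical
  show (if v ∈ S then locS v else _) = locS v
  rw [if_pos hv]

/-- **An UNRAMIFIED₂ tensor re-presented at the integral levels with a larger bad set has the same local factors.** [cite: Rogawski1990, §14.3 p. 233] -/
theorem loc_ofUnramified₂_of_isUnramified₂ (T : PureTensor₂ L H₂ H₁) (hT : T.IsUnramified₂)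
    (S' : Finset (HeightOneSpectrum (𝓞 ↥(maximalRealSubfield L)))) (hS : T.S ⊆ S') (v : HeightOneSpectrum (𝓞 ↥(maximalRealSubfield L))) :
    (ofUnramified₂ L H₂ H₁ S' T.loc T.arch).loc v = T.loc v := by
  classical
  by_cases hv : v ∈ S'
  · exact loc_ofUnramified₂_of_mem S' T.loc T.arch hv
  · rw [(ofUnramified₂ L H₂ H₁ S' T.loc T.arch).loc_eq_indicator v (by rwa [ofUnramified₂_S]), T.loc_eq_indicator v (fun h => hv (hS h)),
      (hT v (fun h => hv (hS h))).1, (hT v (fun h => hv (hS h))).2]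
    rfl

/-- **… and is the same function**: `(ofUnramified₂ S′ T.loc T.arch).eval = T.eval` for `T.IsUnramified₂`, `T.S ⊆ S′`. [cite: Rogawski1990, §14.3 p. 233] [cite: BorelJacquet1979, §4.1] -/
theorem eval_ofUnramified₂_of_isUnramified₂ (T : PureTensor₂ L H₂ H₁) (hT : T.IsUnramified₂)
    (S' : Finset (HeightOneSpectrum (𝓞 ↥(maximalRealSubfield L)))) (hS : T.S ⊆ S') :
    (ofUnramified₂ L H₂ H₁ S' T.loc T.arch).eval = T.eval := by
  classical
  set T' := ofUnramified₂ L H₂ H₁ S' T.loc T.arch with hT'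
  have hloc : ∀ v, T'.loc v = T.loc v := loc_ofUnramified₂_of_isUnramified₂ T hT S' hS
  funext p
  by_cases h' : p ∈ T'.unramifiedSet
  · by_cases h : p ∈ T.unramifiedSet
    · rw [T.eval_eq_of_mem h, T'.eval_eq_of_mem h', show T'.S = S' from rfl, show T'.arch = T.arch from rfl, ← Finset.prod_sdiff hS]
      have h1 : ∏ v ∈ S' \ T.S, T'.loc v (locPair v p) = 1 := by
        refine Finset.prod_eq_one fun v hv => ?_
        rw [Finset.mem_sdiff] at hv
        rw [hloc v, T.loc_eq_indicator v hv.2]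
        exact Set.indicator_of_mem (Set.mk_mem_prod (h v hv.2).1 (h v hv.2).2) _
      rw [h1, one_mul]
      exact congrArg _ (Finset.prod_congr rfl fun v _ => by rw [hloc v])
    · obtain ⟨v, hv, hgv⟩ : ∃ v, v ∉ T.S ∧ ¬ ((cmDatum L N₂ H₂).toLocal v p.1 ∈ T.K₂ v ∧ (cmDatum L N₁ H₁).toLocal v p.2 ∈ T.K₁ v) := by
        by_contra hc
        push Not at hc
        exact h fun v hv => hc v hv
      have hvS' : v ∈ S' := by
        by_contra hv'
        refine hgv ?_
        rw [(hT v hv).1, (hT v hv).2]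
        exact h' v hv'
      rw [T.eval_eq_zero_of_not_mem h, T'.eval_eq_of_mem h', show T'.S = S' from rfl]
      refine mul_eq_zero_of_right _ (Finset.prod_eq_zero hvS' ?_)
      rw [hloc v, T.loc_eq_indicator v hv]
      exact Set.indicator_of_notMem (fun hp => hgv ⟨hp.1, hp.2⟩) _
  · obtain ⟨v, hv', hgv⟩ : ∃ v, v ∉ T'.S ∧ ¬ ((cmDatum L N₂ H₂).toLocal v p.1 ∈ T'.K₂ v ∧ (cmDatum L N₁ H₁).toLocal v p.2 ∈ T'.K₁ v) := by
      by_contra hc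
      push Not at hc
      exact h' fun v hv => hc v hv
    have hv : v ∉ T.S := fun h => hv' (hS h)
    have hgv' : ¬ ((cmDatum L N₂ H₂).toLocal v p.1 ∈ T.K₂ v ∧ (cmDatum L N₁ H₁).toLocal v p.2 ∈ T.K₁ v) := by
      rw [(hT v hv).1, (hT v hv).2]; exact hgv
    rw [T'.eval_eq_zero_of_not_mem h', T.eval_eq_zero_of_not_mem fun hp => hgv' (hp v hv)]

end Literature.NumberTheory.Automorphic.UnitaryGroup.PureTensor₂

namespace Summit.HodgeConjecture.HodgeConjecture.Cruxes.H413.F0P3SpectralPacket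

open Summit.HodgeConjecture.HodgeConjecture.Cruxes.H413.F0P3GlobalPacket
open Summit.HodgeConjecture.HodgeConjecture.Cruxes.H413.F0P3LocalPacketKit

variable {L : Type} [Field L] [NumberField L] [IsCMField L] {H' : Matrix (Fin 3) (Fin 3) L}
  {𝔩 : ∀ v : HeightOneSpectrum (𝓞 ↥(maximalRealSubfield L)), LocalPacketKit L H' v} {𝔞 : ArchPacketKit} {𝔞H : ArchPacketKitH 𝔞}
  {DiscH : GlobalPacketH 𝔩 → 𝔞H.PktInfH → Prop}

namespace SpectralPacketH

/-! ## §2 `trH` total on `TestH L` [§13.3 p. 203; §14.3 pp. 233–234] -/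

/-- **(h1) `ρ.IsTestPresentationH F TH` — `TH` PRESENTS `F ∈ C_c(H(𝔸))` AS AN UNRAMIFIED₂ PURE TENSOR AT THE INTEGRAL LEVELS WITH BAD SET `⊇ ramH ρ`**:
`TH.IsUnramified₂`, all levels integral, `ρ.ramFinsetH ⊆ TH.S`, `⇑F = TH.eval` (twin of ★ FILE 3d `IsTestPresentation`; the smoothness of pin (xi″-c) is not needed to define
the value). [cite: Rogawski1990, §14.3 pp. 233–234; §13.3 p. 203] -/
def IsTestPresentationH (ρ : SpectralPacketH 𝔩 𝔞 𝔞H DiscH) (F : TestH L)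
    (TH : UnitaryGroup.PureTensor₂ L (splitForm L 2) (splitForm L 1)) : Prop :=
  TH.IsUnramified₂ ∧
    (∀ v : HeightOneSpectrum (𝓞 ↥(maximalRealSubfield L)), TH.K₂ v = cmLocalIntegralLevel L 2 (splitForm L 2) v ∧ TH.K₁ v = cmLocalIntegralLevel L 1 (splitForm L 1) v) ∧
    ρ.ramFinsetH ⊆ TH.S ∧ ⇑F = TH.eval

/-- **Every unramified₂ pure tensor has a test presentation** with bad set `⊇ TH.S`, the same archimedean and local factors (§1 `ofUnramified₂` at `TH.S ∪ ramH ρ`).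
[cite: Rogawski1990, §14.3 pp. 233–234] -/
theorem exists_isTestPresentationH (ρ : SpectralPacketH 𝔩 𝔞 𝔞H DiscH) {F : TestH L} {TH : UnitaryGroup.PureTensor₂ L (splitForm L 2) (splitForm L 1)}
    (hT : TH.IsUnramified₂) (hF : ⇑F = TH.eval) :
    ∃ TH' : UnitaryGroup.PureTensor₂ L (splitForm L 2) (splitForm L 1), ρ.IsTestPresentationH F TH' ∧ TH.S ⊆ TH'.S ∧ TH'.arch = TH.arch ∧
      ∀ v : HeightOneSpectrum (𝓞 ↥(maximalRealSubfield L)), TH'.loc v = TH.loc v := by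
  classical
  refine ⟨UnitaryGroup.PureTensor₂.ofUnramified₂ L (splitForm L 2) (splitForm L 1) (TH.S ∪ ρ.ramFinsetH) TH.loc TH.arch,
    ⟨UnitaryGroup.PureTensor₂.ofUnramified₂_isUnramified₂ _ _ _, fun _ => ⟨rfl, rfl⟩, ?_, ?_⟩, ?_, rfl,
    UnitaryGroup.PureTensor₂.loc_ofUnramified₂_of_isUnramified₂ TH hT _ Finset.subset_union_left⟩
  · rw [UnitaryGroup.PureTensor₂.ofUnramified₂_S]
    exact Finset.subset_union_right
  · rw [hF, TH.eval_ofUnramified₂_of_isUnramified₂ hT _ Finset.subset_union_left]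
  · rw [UnitaryGroup.PureTensor₂.ofUnramified₂_S]
    exact Finset.subset_union_left

variable [∀ v : HeightOneSpectrum (𝓞 ↥(maximalRealSubfield L)), MeasurableSpace ((cmDatum L 2 (splitForm L 2)).Local v × (cmDatum L 1 (splitForm L 1)).Local v)]

/-- **(h2) `ρ.trTensorH νH archTrH TH := Tr ρ_∞(TH.arch) · ∏_{v ∈ TH.S} Tr ρ_v(TH.loc v)`** (★ FILE 3g `trPktInfH` at the `H_∞`-characters `archTrH`, ★ FILE 3g `trFinAt` = ★ FILE 1 `trPktH`).
[cite: Rogawski1990, §13.3 p. 203; §13.1 Thm. 13.1.1 p. 198] -/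
def trTensorH (ρ : SpectralPacketH 𝔩 𝔞 𝔞H DiscH)
    (νH : ∀ v : HeightOneSpectrum (𝓞 ↥(maximalRealSubfield L)), Measure ((cmDatum L 2 (splitForm L 2)).Local v × (cmDatum L 1 (splitForm L 1)).Local v))
    (archTrH : 𝔞H.CinfH → (UnitaryGroup.arch (↥(maximalRealSubfield L)) L (IsCMField.complexConj L) 2 (splitForm L 2) ×
      UnitaryGroup.arch (↥(maximalRealSubfield L)) L (IsCMField.complexConj L) 1 (splitForm L 1) → ℂ) → ℂ)
    (TH : UnitaryGroup.PureTensor₂ L (splitForm L 2) (splitForm L 1)) : ℂ :=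
  𝔞H.trPktInfH archTrH ρ.inf TH.arch * ∏ v ∈ TH.S, ρ.trFinAt v (νH v) (TH.loc v)

/-- **(h3) `ρ.trH νH archTrH : TestH L → ℂ` — THE TUPLE'S `trH ρ`: `Tr ρ(f^H)` as a total functional** (`trTensorH` of SOME test presentation if one exists, `0` otherwise — a value no
consumer reads: clause (T) meets only matched `f^H`, unramified₂ pure tensors by pin (xi″-c) `IsPinned.deltaTransfer_tensors`). [cite: Rogawski1990, §13.3 p. 203; §14.3 pp. 233–234; §14.6 (14.6.1) p. 241] -/
def trH (ρ : SpectralPacketH 𝔩 𝔞 𝔞H DiscH)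
    (νH : ∀ v : HeightOneSpectrum (𝓞 ↥(maximalRealSubfield L)), Measure ((cmDatum L 2 (splitForm L 2)).Local v × (cmDatum L 1 (splitForm L 1)).Local v))
    (archTrH : 𝔞H.CinfH → (UnitaryGroup.arch (↥(maximalRealSubfield L)) L (IsCMField.complexConj L) 2 (splitForm L 2) ×
      UnitaryGroup.arch (↥(maximalRealSubfield L)) L (IsCMField.complexConj L) 1 (splitForm L 1) → ℂ) → ℂ)
    (F : TestH L) : ℂ :=
  open scoped Classical in
  if h : ∃ TH : UnitaryGroup.PureTensor₂ L (splitForm L 2) (splitForm L 1), ρ.IsTestPresentationH F TH then ρ.trTensorH νH archTrH h.choose else 0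

/-- **(h4) (TF-ind)-H `ρ.PresentationIndepH νH archTrH`** — two test presentations of one `F ∈ C_c(H(𝔸))` have the same `trTensorH` (the ONE residual law of `trH`; in-house by the
★ FILE 3d′ generic `mul_prod_eq_of_forall_mul_prod_eq` + an `H(𝔸)` box-surjectivity twin — next brick). [cite: Rogawski1990, §13.3 p. 203] -/
def PresentationIndepH (ρ : SpectralPacketH 𝔩 𝔞 𝔞H DiscH)
    (νH : ∀ v : HeightOneSpectrum (𝓞 ↥(maximalRealSubfield L)), Measure ((cmDatum L 2 (splitForm L 2)).Local v × (cmDatum L 1 (splitForm L 1)).Local v))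
    (archTrH : 𝔞H.CinfH → (UnitaryGroup.arch (↥(maximalRealSubfield L)) L (IsCMField.complexConj L) 2 (splitForm L 2) ×
      UnitaryGroup.arch (↥(maximalRealSubfield L)) L (IsCMField.complexConj L) 1 (splitForm L 1) → ℂ) → ℂ) : Prop :=
  ∀ (F : TestH L) (TH TH' : UnitaryGroup.PureTensor₂ L (splitForm L 2) (splitForm L 1)),
    ρ.IsTestPresentationH F TH → ρ.IsTestPresentationH F TH' → ρ.trTensorH νH archTrH TH = ρ.trTensorH νH archTrH TH'

/-- **(h5) (TF-1)-H `ρ.UnramTraceOneH νH`** — «`Tr ρ_v(1_{K_{H,v}}) = 1` at every place where `ξ_H(ρ_v)` is unramified» (the normalisation making `∏_v Tr ρ_v(f^H_v)` well-defined,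
p. 203 l. 1–3, `H`-side). [cite: Rogawski1990, §13.3 p. 203 l. 1–3] -/
def UnramTraceOneH (ρ : SpectralPacketH 𝔩 𝔞 𝔞H DiscH)
    (νH : ∀ v : HeightOneSpectrum (𝓞 ↥(maximalRealSubfield L)), Measure ((cmDatum L 2 (splitForm L 2)).Local v × (cmDatum L 1 (splitForm L 1)).Local v)) : Prop :=
  ∀ v : HeightOneSpectrum (𝓞 ↥(maximalRealSubfield L)), (𝔩 v).unr ((𝔩 v).xiH (ρ.fin.loc v)) →
    ρ.trFinAt v (νH v) ((((cmLocalIntegralLevel L 2 (splitForm L 2) v : Set ((cmDatum L 2 (splitForm L 2)).Local v)) ×ˢ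
      (cmLocalIntegralLevel L 1 (splitForm L 1) v : Set ((cmDatum L 1 (splitForm L 1)).Local v)))).indicator fun _ => 1) = 1

variable {ρ : SpectralPacketH 𝔩 𝔞 𝔞H DiscH}
  {νH : ∀ v : HeightOneSpectrum (𝓞 ↥(maximalRealSubfield L)), Measure ((cmDatum L 2 (splitForm L 2)).Local v × (cmDatum L 1 (splitForm L 1)).Local v)}
  {archTrH : 𝔞H.CinfH → (UnitaryGroup.arch (↥(maximalRealSubfield L)) L (IsCMField.complexConj L) 2 (splitForm L 2) ×
    UnitaryGroup.arch (↥(maximalRealSubfield L)) L (IsCMField.complexConj L) 1 (splitForm L 1) → ℂ) → ℂ}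

/-- Unfolding of (h2). [cite: Rogawski1990, §13.3 p. 203] -/
theorem trTensorH_eq (TH : UnitaryGroup.PureTensor₂ L (splitForm L 2) (splitForm L 1)) :
    ρ.trTensorH νH archTrH TH = 𝔞H.trPktInfH archTrH ρ.inf TH.arch * ∏ v ∈ TH.S, ρ.trFinAt v (νH v) (TH.loc v) :=
  rfl

/-- **The junk clause**: off the presented unramified₂ tensors, `Tr ρ(F) := 0`. [cite: Rogawski1990, §13.3 p. 203] -/
theorem trH_of_not {F : TestH L} (h : ¬ ∃ TH : UnitaryGroup.PureTensor₂ L (splitForm L 2) (splitForm L 1), ρ.IsTestPresentationH F TH) :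
    ρ.trH νH archTrH F = 0 := by
  rw [trH, dif_neg h]

/-- **Under (TF-ind)-H, `Tr ρ(F)` is the product of ANY test presentation of `F`.** [cite: Rogawski1990, §13.3 p. 203] -/
theorem trH_eq_trTensorH (hind : ρ.PresentationIndepH νH archTrH) {F : TestH L} {TH : UnitaryGroup.PureTensor₂ L (splitForm L 2) (splitForm L 1)}
    (hT : ρ.IsTestPresentationH F TH) : ρ.trH νH archTrH F = ρ.trTensorH νH archTrH TH := by
  have h : ∃ TH' : UnitaryGroup.PureTensor₂ L (splitForm L 2) (splitForm L 1), ρ.IsTestPresentationH F TH' := ⟨TH, hT⟩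
  rw [trH, dif_pos h]
  exact hind F _ _ h.choose_spec hT

/-- Under (TF-1)-H, extra places off `TH.S` (where the factor is the unit and `ξ_H(ρ_v)` is unramified) do not change the product. [cite: Rogawski1990, §13.3 p. 203 l. 1–3] -/
theorem trTensorH_eq_prod_of_subset (h1 : ρ.UnramTraceOneH νH) {F : TestH L} {TH : UnitaryGroup.PureTensor₂ L (splitForm L 2) (splitForm L 1)}
    (hT : ρ.IsTestPresentationH F TH) (S' : Finset (HeightOneSpectrum (𝓞 ↥(maximalRealSubfield L)))) (hS : TH.S ⊆ S') :
    ρ.trTensorH νH archTrH TH = 𝔞H.trPktInfH archTrH ρ.inf TH.arch * ∏ v ∈ S', ρ.trFinAt v (νH v) (TH.loc v) := by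
  have hprod : ∏ v ∈ TH.S, ρ.trFinAt v (νH v) (TH.loc v) = ∏ v ∈ S', ρ.trFinAt v (νH v) (TH.loc v) :=
    Finset.prod_subset hS fun v _ hv => by
      rw [TH.loc_eq_indicator v hv, (hT.2.1 v).1, (hT.2.1 v).2]
      exact h1 v (ρ.unr_xiH_of_not_mem_ramFinsetH fun h => hv (hT.2.2.1 h))
  rw [trTensorH_eq, hprod]

end SpectralPacketH

end Summit.HodgeConjecture.HodgeConjecture.Cruxes.H413.F0P3SpectralPacket

/-! ## §3 The `H`-side e.v.p. slot `evpH` [§13.7 p. 206; Thm. 13.3.4] -/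

namespace Summit.HodgeConjecture.HodgeConjecture.Cruxes.H413.F0P3GlobalPacket.GlobalPacket

open Summit.HodgeConjecture.HodgeConjecture.Cruxes.H413.F0P3LocalPacketKit

variable {L : Type} [Field L] [NumberField L] [IsCMField L]
  {H : Matrix (Fin 3) (Fin 3) L} {𝔩₀ : ∀ v : HeightOneSpectrum (𝓞 ↥(maximalRealSubfield L)), LocalPacketKit L (splitForm L 3) v}

/-- **(h6) `Pg.evpAtψ ψ νG` — ★ FILE 3f's `evpGψ` at the level of a finite-place packet `Pg`** (it only reads `Q.fin`): on a test function `f′ : G′_v → ℂ` of level `K′_v`,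
`Pg.evpAt v (νG v) (f′ ∘ ψ_v⁻¹)`, else `0`. [cite: Rogawski1990, §13.7 p. 206; §14.2 p. 232] [cite: CartierCorvallis1979, §IV.1] -/
def evpAtψ (Pg : GlobalPacket 𝔩₀)
    (ψ : ∀ v : HeightOneSpectrum (𝓞 ↥(maximalRealSubfield L)), (cmDatum L 3 H).Local v ≃ₜ* (cmDatum L 3 (splitForm L 3)).Local v)
    [∀ v : HeightOneSpectrum (𝓞 ↥(maximalRealSubfield L)), MeasurableSpace ((cmDatum L 3 (splitForm L 3)).Local v)]
    (νG : ∀ v : HeightOneSpectrum (𝓞 ↥(maximalRealSubfield L)), Measure ((cmDatum L 3 (splitForm L 3)).Local v))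
    (v : HeightOneSpectrum (𝓞 ↥(maximalRealSubfield L))) (f : (cmDatum L 3 H).Local v → ℂ) : ℂ :=
  open scoped Classical in
  if HasCompactSupport f ∧ IsLevel (cmLocalIntegralLevel L 3 H v) f then Pg.evpAt v (νG v) (f ∘ (ψ v).symm) else 0

/-- (P5) at the `G′`-frame by definition. [cite: Rogawski1990, §13.7 p. 206] -/
theorem evpAtψ_of_not (Pg : GlobalPacket 𝔩₀)
    {ψ : ∀ v : HeightOneSpectrum (𝓞 ↥(maximalRealSubfield L)), (cmDatum L 3 H).Local v ≃ₜ* (cmDatum L 3 (splitForm L 3)).Local v}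
    [∀ v : HeightOneSpectrum (𝓞 ↥(maximalRealSubfield L)), MeasurableSpace ((cmDatum L 3 (splitForm L 3)).Local v)]
    {νG : ∀ v : HeightOneSpectrum (𝓞 ↥(maximalRealSubfield L)), Measure ((cmDatum L 3 (splitForm L 3)).Local v)}
    {v : HeightOneSpectrum (𝓞 ↥(maximalRealSubfield L))} {f : (cmDatum L 3 H).Local v → ℂ}
    (hf : ¬ (HasCompactSupport f ∧ IsLevel (cmLocalIntegralLevel L 3 H v) f)) : Pg.evpAtψ ψ νG v f = 0 := by
  rw [evpAtψ, if_neg hf]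

end Summit.HodgeConjecture.HodgeConjecture.Cruxes.H413.F0P3GlobalPacket.GlobalPacket

namespace Summit.HodgeConjecture.HodgeConjecture.Cruxes.H413.F0P3SpectralPacket

open Summit.HodgeConjecture.HodgeConjecture.Cruxes.H413.F0P3GlobalPacket
open Summit.HodgeConjecture.HodgeConjecture.Cruxes.H413.F0P3LocalPacketKit

variable {L : Type} [Field L] [NumberField L] [IsCMField L] {H : Matrix (Fin 3) (Fin 3) L}
  {𝔩₀ : ∀ v : HeightOneSpectrum (𝓞 ↥(maximalRealSubfield L)), LocalPacketKit L (splitForm L 3) v} {𝔞₀ : ArchPacketKit} {𝔞H₀ : ArchPacketKitH 𝔞₀}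
  {μ₀ : Measure (adelicGroupData (↥(maximalRealSubfield L)) L (IsCMField.complexConj L) 3 (splitForm L 3)).automorphicQuotient}
  [SMulInvariantMeasure (adelicGroupData (↥(maximalRealSubfield L)) L (IsCMField.complexConj L) 3 (splitForm L 3)).Adelic
    (adelicGroupData (↥(maximalRealSubfield L)) L (IsCMField.complexConj L) 3 (splitForm L 3)).automorphicQuotient μ₀]
  {DiscH₀ : GlobalPacketH 𝔩₀ → 𝔞H₀.PktInfH → Prop}

/-- ★ FILE 3f's `evpGψ` IS `evpAtψ` of the finite part (`rfl`). [cite: Rogawski1990, §13.7 p. 206] -/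
theorem SpectralPacketG.evpGψ_eq_evpAtψ (Q : SpectralPacketG 𝔩₀ 𝔞₀ μ₀)
    (ψ : ∀ v : HeightOneSpectrum (𝓞 ↥(maximalRealSubfield L)), (cmDatum L 3 H).Local v ≃ₜ* (cmDatum L 3 (splitForm L 3)).Local v)
    [∀ v : HeightOneSpectrum (𝓞 ↥(maximalRealSubfield L)), MeasurableSpace ((cmDatum L 3 (splitForm L 3)).Local v)]
    (νG : ∀ v : HeightOneSpectrum (𝓞 ↥(maximalRealSubfield L)), Measure ((cmDatum L 3 (splitForm L 3)).Local v)) :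
    Q.evpGψ ψ νG = Q.fin.evpAtψ ψ νG :=
  rfl

/-- **(h6) `ρ.evpHψ ψ νG : EvpData L H` — THE TUPLE'S `evpH ρ`**: the e.v.p. of `Π(ρ) = ξ_H(ρ)` (★ FILE 3g `imageG`) read on `G′_v` through `ψ_v` (print §13.7 p. 206:
`t(Π(ρ)) = ξ_H(t(ρ))`; the letter compares `evpH (ρXi ξ)` with `tXi ξ` off `S`). [cite: Rogawski1990, §13.7 p. 206; §13.3 Thm. 13.3.4 p. 202; §14.2 p. 232] -/
def SpectralPacketH.evpHψ (ρ : SpectralPacketH 𝔩₀ 𝔞₀ 𝔞H₀ DiscH₀)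
    (ψ : ∀ v : HeightOneSpectrum (𝓞 ↥(maximalRealSubfield L)), (cmDatum L 3 H).Local v ≃ₜ* (cmDatum L 3 (splitForm L 3)).Local v)
    [∀ v : HeightOneSpectrum (𝓞 ↥(maximalRealSubfield L)), MeasurableSpace ((cmDatum L 3 (splitForm L 3)).Local v)]
    (νG : ∀ v : HeightOneSpectrum (𝓞 ↥(maximalRealSubfield L)), Measure ((cmDatum L 3 (splitForm L 3)).Local v))
    (v : HeightOneSpectrum (𝓞 ↥(maximalRealSubfield L))) (f : (cmDatum L 3 H).Local v → ℂ) : ℂ :=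
  ρ.imageG.evpAtψ ψ νG v f

/-- (P5) for `evpH` by definition. [cite: Rogawski1990, §13.7 p. 206] -/
theorem SpectralPacketH.evpHψ_of_not (ρ : SpectralPacketH 𝔩₀ 𝔞₀ 𝔞H₀ DiscH₀)
    {ψ : ∀ v : HeightOneSpectrum (𝓞 ↥(maximalRealSubfield L)), (cmDatum L 3 H).Local v ≃ₜ* (cmDatum L 3 (splitForm L 3)).Local v}
    [∀ v : HeightOneSpectrum (𝓞 ↥(maximalRealSubfield L)), MeasurableSpace ((cmDatum L 3 (splitForm L 3)).Local v)]
    {νG : ∀ v : HeightOneSpectrum (𝓞 ↥(maximalRealSubfield L)), Measure ((cmDatum L 3 (splitForm L 3)).Local v)}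
    {v : HeightOneSpectrum (𝓞 ↥(maximalRealSubfield L))} {f : (cmDatum L 3 H).Local v → ℂ}
    (hf : ¬ (HasCompactSupport f ∧ IsLevel (cmLocalIntegralLevel L 3 H v) f)) : ρ.evpHψ ψ νG v f = 0 :=
  ρ.imageG.evpAtψ_of_not hf

/-! ## §4 The `H`-side semilocal trace slot `trHS` on `G′`-data [Thm. 13.1.1 (2); Prop. 12.3.3; §14.6 p. 243] -/

/-- **(h7) `ρ.trHSψ ψ S νG archTr′ fS` — THE TUPLE'S `trHS S ρ`: the ENDOSCOPIC READING of `Tr ρ_{S,∞}((f′_{S,∞})^H)` on the `G′`-semilocal datum ★ `TestS₀ L H ι T hT S`** —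
★ FILE 3g `endoTrPktInf` at the compact-side characters `archTr′` (the closer's ★ `archTr₀`) times the finite endoscopic sums §0 `endoTrPkt` at `fS.loc v ∘ ψ_v⁻¹` (twin of ★ FILE 3f
`trSψ`; the character identities Thm. 13.1.1 (2) ∕ Prop. 12.3.3 say this IS `Tr ρ(f^H)` at matched data — typed by the consumer). [cite: Rogawski1990, §13.1 Thm. 13.1.1 p. 198; §12.3 Prop. 12.3.3 p. 178; §14.6 p. 243] -/
def SpectralPacketH.trHSψ (ρ : SpectralPacketH 𝔩₀ 𝔞₀ 𝔞H₀ DiscH₀)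
    (ψ : ∀ v : HeightOneSpectrum (𝓞 ↥(maximalRealSubfield L)), (cmDatum L 3 H).Local v ≃ₜ* (cmDatum L 3 (splitForm L 3)).Local v)
    {ι : L →+* ℂ} {T : GL (Fin 3) ℂ} {hT : (T : Matrix (Fin 3) (Fin 3) ℂ)ᴴ * H.map ι * (T : Matrix (Fin 3) (Fin 3) ℂ) = Literature.Geometry.ComplexHyperbolic.BallModel.J}
    (S : Finset (HeightOneSpectrum (𝓞 ↥(maximalRealSubfield L))))
    [∀ v : HeightOneSpectrum (𝓞 ↥(maximalRealSubfield L)), MeasurableSpace ((cmDatum L 3 (splitForm L 3)).Local v)]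
    (νG : ∀ v : HeightOneSpectrum (𝓞 ↥(maximalRealSubfield L)), Measure ((cmDatum L 3 (splitForm L 3)).Local v))
    (archTr' : GKIrrClass (uFormGroup (Fin 2) (Fin 1)) → (UnitaryGroup.arch (↥(maximalRealSubfield L)) L (IsCMField.complexConj L) 3 H → ℂ) → ℂ)
    (fS : TestS₀ L H ι T hT S) : ℂ :=
  𝔞H₀.endoTrPktInf archTr' ρ.inf fS.arch * ∏ v : ↥S, (𝔩₀ v.1).endoTrPkt (νG v.1) (ρ.fin.loc v.1) (fS.loc v ∘ (ψ v.1).symm)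

/-- Unfolding of (h7). [cite: Rogawski1990, §13.1 Thm. 13.1.1 p. 198; §14.6 p. 243] -/
theorem SpectralPacketH.trHSψ_eq (ρ : SpectralPacketH 𝔩₀ 𝔞₀ 𝔞H₀ DiscH₀)
    (ψ : ∀ v : HeightOneSpectrum (𝓞 ↥(maximalRealSubfield L)), (cmDatum L 3 H).Local v ≃ₜ* (cmDatum L 3 (splitForm L 3)).Local v)
    {ι : L →+* ℂ} {T : GL (Fin 3) ℂ} {hT : (T : Matrix (Fin 3) (Fin 3) ℂ)ᴴ * H.map ι * (T : Matrix (Fin 3) (Fin 3) ℂ) = Literature.Geometry.ComplexHyperbolic.BallModel.J}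
    (S : Finset (HeightOneSpectrum (𝓞 ↥(maximalRealSubfield L))))
    [∀ v : HeightOneSpectrum (𝓞 ↥(maximalRealSubfield L)), MeasurableSpace ((cmDatum L 3 (splitForm L 3)).Local v)]
    (νG : ∀ v : HeightOneSpectrum (𝓞 ↥(maximalRealSubfield L)), Measure ((cmDatum L 3 (splitForm L 3)).Local v))
    (archTr' : GKIrrClass (uFormGroup (Fin 2) (Fin 1)) → (UnitaryGroup.arch (↥(maximalRealSubfield L)) L (IsCMField.complexConj L) 3 H → ℂ) → ℂ)
    (fS : TestS₀ L H ι T hT S) :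
    ρ.trHSψ ψ S νG archTr' fS = 𝔞H₀.endoTrPktInf archTr' ρ.inf fS.arch * ∏ v : ↥S, (𝔩₀ v.1).endoTrPkt (νG v.1) (ρ.fin.loc v.1) (fS.loc v ∘ (ψ v.1).symm) :=
  rfl

end Summit.HodgeConjecture.HodgeConjecture.Cruxes.H413.F0P3SpectralPacket

end
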